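import Mathlib.Analysis.SpecialFunctions.Pow.Deriv
import Mathlib.Analysis.Calculus.Deriv.MeanValue
import Mathlib.MeasureTheory.Integral.IntervalIntegral.FundThmCalculus
import Literature.NumberTheory.Sieve.SieveFunctions
import HarnessLib

/-!
# The adjoint equation and the inner product of the Rosser–Iwaniec `β`-sieve

Trunk `AntSieve` (topic `NumberTheory/Sieve`). For the delay-differential system of the `β`-sieve
of dimension `κ` (`IsBetaSieveSolution`, file `SieveFunctions`) the combinations `P = F + f`,
`Q = F − f` satisfy `s R'(s) + a R(s) + b R(s − 1) = 0` with `(a, b) = (κ, ∓κ)`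
[Greaves2001, §4.2.1 (1.13)]. Iwaniec's method [IwaniecActaArith1980, §3] studies them through the
ADJOINT equation `(s r(s))' = a r(s) + b r(s + 1)` [Greaves2001, §4.2.2 (2.2)–(2.3)] and the
INNER PRODUCT `⟨R, r⟩(s) = s r(s) R(s) − b ∫_{s−1}^{s} r(x + 1) R(x) dx` [Greaves2001, (2.4)], which
is constant in `s` [Greaves2001, Lemma 4.2.1]. This file proves these facts and draws the
consequences that pin down the sifting limit `β_κ` — in particular the step "every normalised
solution has `g_κ(β − 1) = 0` or `β = 1`" that the correction section of `SieveFunctions`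
(`IsGreatestBetaSieveData`; Iwaniec's `g, h` are Greaves' `q, p`) uses in its docstrings without
formalising it:

* `IsSieveAdjoint a b r`, `sieveInnerProduct b R r s` (definitions, with the source's formulas);
* `sieveInnerProduct_eq` — [Greaves2001, Lemma 4.2.1 (i)–(ii)]: for `R` continuous on `(0, ∞)`
  with `R(x) = A x^{−a}` on `(0, β]`, `β > 1`, solving the delay equation on `(β, ∞) ∖ {β + 1}`,
  and `r` adjoint on `(0, ∞)`, `⟨R, r⟩(s) = A (β − 1)^{1−a} r(β − 1)` for all `s ≥ β` (PROVED);
* `IsBetaSieveSolution.sieveInnerProduct_sub_eq` / `…_add_eq` — the cases `Q = F − f`, `q`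
  (`b = κ`) and `P = F + f`, `p` (`b = −κ`) [Greaves2001, §4.2.4 (4.2), (4.4), (4.7)] (PROVED);
* `IsBetaSieveSolution.adjoint_apply_eq_zero` — NECESSITY of `q(β − 1) = 0`: for a normalised
  solution (`F, f = 1 + O(e^{−s})`) with `β > 1` and any adjoint `q` of polynomial growth,
  `q(β − 1) = 0` [Greaves2001, §4.2.4, (4.7) with `B = 0`, and (4.2.4.10)] (PROVED);
* `IsBetaSieveSolution.const_eq` — the constant `A = 2 (β − 1)^{κ−1} / p(β − 1)` for any adjoint
  `p` with `s p(s) → 1` [Greaves2001, Lemma 4.2.5 (4.11)] (PROVED);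
* `IsBetaSieveSolution.one_lt` — `β > 1` for `κ ≥ 1` (PROVED);
* the polynomial adjoints `q_{1/2} = 1`, `q_1 = s − 1`, `q_2 = s³ − 6s² + 9s − 8/3`
  [Greaves2001, §4.2.3 (3.3)] (PROVED), whence `IsBetaSieveSolution.beta_eq_two` (`κ = 1`: every
  normalised solution has `β = 2`, so `siftingLimit_one` follows from `exists_isBetaSieveData`:
  `siftingLimit_one_of_exists`) and `IsBetaSieveSolution.cubic_eq_zero` (`κ = 2`: `β − 1` is a
  root of `q_2`, i.e. `β ∈ {1.39209, 2.77393, 4.83399}` numerically) (PROVED).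

## References

* [Greaves2001] G. Greaves, *Sieves in Number Theory*, Springer (2001), §4.2.1 (1.8)–(1.13),
  §4.2.2 (2.1)–(2.10) and Lemma 4.2.1, §4.2.3 (3.3), §4.2.4 (4.2), (4.4), (4.7), (4.10), Lemma 4.2.5.
* [IwaniecActaArith1980] H. Iwaniec, *Rosser's sieve*, Acta Arith. 36 (1980), 171–202, §3.
-/

open Filter Asymptotics Set Topology MeasureTheory

noncomputable section

namespace Literature.NumberTheory.Sieve

/-! ### The adjoint equation -/

/-- `IsSieveAdjoint a b r`: `r` solves, on `(0, ∞)`, the equation adjoint to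
`s R'(s) + a R(s) + b R(s − 1) = 0`, namely `(s r(s))' = a r(s) + b r(s + 1)`
[Greaves2001, §4.2.2 (2.2)], written in the equivalent form `(s^{1−a} r(s))' = b s^{−a} r(s + 1)`
[Greaves2001, §4.2.2 (2.10)] (which needs no separate differentiability hypothesis on `r`). The
cases `(a, b) = (κ, κ)` and `(κ, −κ)` are Iwaniec's adjoint functions `q = q_κ` and `p = p_κ` of the
`β`-sieve [Greaves2001, §4.2.2 (2.3)]. [cite: Greaves2001, §4.2.2 (2.2)–(2.3) and (2.10)] -/
def IsSieveAdjoint (a b : ℝ) (r : ℝ → ℝ) : Prop :=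
  ∀ s : ℝ, 0 < s → HasDerivAt (fun t : ℝ => t ^ (1 - a) * r t) (b * s ^ (-a) * r (s + 1)) s

/-- The inner product `⟨R, r⟩(s) = s r(s) R(s) − b ∫_{s−1}^{s} r(x + 1) R(x) dx` of a solution `R`
of `s R'(s) + a R(s) + b R(s − 1) = 0` against a solution `r` of the adjoint equation
[Greaves2001, §4.2.2 (2.4)]. [cite: Greaves2001, §4.2.2 (2.4)] -/
def sieveInnerProduct (b : ℝ) (R r : ℝ → ℝ) (s : ℝ) : ℝ :=
  s * r s * R s - b * ∫ x in (s - 1)..s, r (x + 1) * R x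

/-- Unfolding lemma for `sieveInnerProduct`. [folklore] -/
theorem sieveInnerProduct_def (b : ℝ) (R r : ℝ → ℝ) (s : ℝ) :
    sieveInnerProduct b R r s = s * r s * R s - b * ∫ x in (s - 1)..s, r (x + 1) * R x :=
  rfl

namespace IsSieveAdjoint

variable {a b : ℝ} {r : ℝ → ℝ}

/-- A solution of the adjoint equation is continuous on `(0, ∞)`. [folklore] -/
theorem continuousAt (hr : IsSieveAdjoint a b r) {s : ℝ} (hs : 0 < s) : ContinuousAt r s := by
  have h1 : ContinuousAt (fun t : ℝ => t ^ (1 - a) * r t) s := (hr s hs).continuousAt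
  have h2 : ContinuousAt (fun t : ℝ => t ^ (a - 1)) s :=
    Real.continuousAt_rpow_const _ _ (Or.inl hs.ne')
  have h3 := h2.mul h1
  refine h3.congr (eventually_of_mem (Ioi_mem_nhds hs) fun t (ht : 0 < t) => ?_)
  show t ^ (a - 1) * (t ^ (1 - a) * r t) = r t
  rw [← mul_assoc, ← Real.rpow_add ht, show a - 1 + (1 - a) = 0 by ring, Real.rpow_zero, one_mul]

/-- A solution of the adjoint equation is continuous on `(0, ∞)`. [folklore] -/
theorem continuousOn (hr : IsSieveAdjoint a b r) : ContinuousOn r (Ioi 0) :=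
  fun _ hs => (hr.continuousAt hs).continuousWithinAt

/-- Scalar multiples of adjoint solutions are adjoint solutions. [folklore] -/
theorem const_mul (hr : IsSieveAdjoint a b r) (c : ℝ) : IsSieveAdjoint a b fun s => c * r s := by
  intro s hs
  have h := (hr s hs).const_mul c
  refine (h.congr_of_eventuallyEq (Eventually.of_forall fun t => ?_)).congr_deriv (by ring)
  simp only; ring

end IsSieveAdjoint

/-! ### Constancy of the inner product [Greaves2001, Lemma 4.2.1] -/

/-- Gluing lemma: a function continuous at every point of `[a, ∞)` whose derivative vanishes on
`(a, ∞)` off one point `c > a` is constant on `[a, ∞)`. [folklore] -/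
theorem eq_of_hasDerivAt_zero_off {Ψ : ℝ → ℝ} {a c : ℝ} (hc : a < c)
    (hcont : ∀ x, a ≤ x → ContinuousAt Ψ x) (hder : ∀ x, a < x → x ≠ c → HasDerivAt Ψ 0 x)
    {x : ℝ} (hx : a ≤ x) : Ψ x = Ψ a := by
  -- constancy on the two open intervals
  have hI : ∀ {u v : ℝ}, u ∈ Ioo a c → v ∈ Ioo a c → Ψ u = Ψ v := by
    intro u v hu hv
    refine isOpen_Ioo.is_const_of_deriv_eq_zero isPreconnected_Ioo
      (fun y hy => (hder y hy.1 hy.2.ne).differentiableAt.differentiableWithinAt)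
      (fun y hy => (hder y hy.1 hy.2.ne).deriv) hu hv
  have hJ : ∀ {u v : ℝ}, u ∈ Ioi c → v ∈ Ioi c → Ψ u = Ψ v := by
    intro u v hu hv
    refine isOpen_Ioi.is_const_of_deriv_eq_zero isPreconnected_Ioi
      (fun y (hy : c < y) => (hder y (hc.trans hy) hy.ne').differentiableAt.differentiableWithinAt)
      (fun y (hy : c < y) => (hder y (hc.trans hy) hy.ne').deriv) hu hv
  set m : ℝ := (a + c) / 2 with hm
  have hma : m ∈ Ioo a c := ⟨by rw [hm]; linarith, by rw [hm]; linarith⟩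
  -- one-sided limits at `a` and `c`
  have key : ∀ {x₀ : ℝ} {F : Filter ℝ} [NeBot F], F ≤ 𝓝 x₀ → a ≤ x₀ → ∀ {S : Set ℝ}, S ∈ F →
      ∀ {K : ℝ}, (∀ y ∈ S, Ψ y = K) → Ψ x₀ = K := by
    intro x₀ F _ hF hx₀ S hS K hK
    have h1 : Tendsto Ψ F (𝓝 (Ψ x₀)) := (hcont x₀ hx₀).tendsto.mono_left hF
    have h2 : Tendsto Ψ F (𝓝 K) :=
      (tendsto_const_nhds (x := K)).congr' (eventually_of_mem hS fun y hy => (hK y hy).symm)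
    exact tendsto_nhds_unique h1 h2
  have hΨa : Ψ a = Ψ m :=
    key (F := 𝓝[>] a) nhdsWithin_le_nhds le_rfl (Ioo_mem_nhdsGT hc) fun y hy => hI hy hma
  have hΨc : Ψ c = Ψ m :=
    key (F := 𝓝[<] c) nhdsWithin_le_nhds hc.le (Ioo_mem_nhdsLT hc) fun y hy => hI hy hma
  have hΨc' : Ψ c = Ψ (c + 1) :=
    key (F := 𝓝[>] c) nhdsWithin_le_nhds hc.le (Ioo_mem_nhdsGT (by linarith : c < c + 2))
      fun y hy => hJ hy.1 (by simp : c + 1 ∈ Ioi c)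
  rcases hx.eq_or_lt with rfl | hax
  · rfl
  rcases lt_trichotomy x c with hxc | rfl | hcx
  · rw [hI ⟨hax, hxc⟩ hma, hΨa]
  · rw [hΨc, hΨa]
  · rw [hJ hcx (by simp : c + 1 ∈ Ioi c), ← hΨc', hΨc, hΨa]

/-- **Constancy and evaluation of the inner product** [Greaves2001, Lemma 4.2.1 (i) and (ii),
(2.5), (2.7)]: let `r` solve the adjoint equation on `(0, ∞)`, let `R` be continuous on `(0, ∞)`
with `R(x) = A x^{−a}` for `0 < x ≤ β`, where `β > 1`, and let `(u^a R(u))' = −b u^{a−1} R(u − 1)`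
for `u > β`, `u ≠ β + 1`. Then `⟨R, r⟩(s) = A (β − 1)^{1−a} r(β − 1)` for every `s ≥ β`.
[cite: Greaves2001, Lemma 4.2.1] -/
theorem sieveInnerProduct_eq {a b β A : ℝ} {R r : ℝ → ℝ} (hβ : 1 < β) (hr : IsSieveAdjoint a b r)
    (hRc : ContinuousOn R (Ioi 0)) (hR0 : ∀ x ∈ Ioc 0 β, R x = A * x ^ (-a))
    (hR : ∀ t : ℝ, β < t → t ≠ β + 1 →
      HasDerivAt (fun u : ℝ => u ^ a * R u) (-b * t ^ (a - 1) * R (t - 1)) t)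
    {s : ℝ} (hs : β ≤ s) :
    sieveInnerProduct b R r s = A * (β - 1) ^ (1 - a) * r (β - 1) := by
  have hβ1 : 0 < β - 1 := sub_pos.mpr hβ
  have hrc : ContinuousOn r (Ioi 0) := hr.continuousOn
  -- the integrand `g` and its primitive `Φ`
  set g : ℝ → ℝ := fun x => r (x + 1) * R x with hg
  have hgc : ContinuousOn g (Ioi 0) := by
    refine ContinuousOn.mul ?_ hRc
    refine hrc.comp (continuousOn_id.add continuousOn_const) fun x (hx : 0 < x) => ?_
    show 0 < x + 1
    linarith
  have hgi : ∀ {u v : ℝ}, 0 < u → 0 < v → IntervalIntegrable g volume u v := by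
    intro u v hu hv
    refine (hgc.mono fun x hx => ?_).intervalIntegrable
    exact lt_of_lt_of_le (lt_min hu hv) hx.1
  set Φ : ℝ → ℝ := fun u => ∫ x in (β - 1)..u, g x with hΦ
  have hΦd : ∀ u : ℝ, 0 < u → HasDerivAt Φ (g u) u := fun u hu =>
    intervalIntegral.integral_hasDerivAt_right (hgi hβ1 hu)
      (hgc.stronglyMeasurableAtFilter isOpen_Ioi u hu) (hgc.continuousAt (Ioi_mem_nhds hu))
  -- `Ψ`, a version of the inner product written with the primitive
  set Ψ : ℝ → ℝ := fun u => u * r u * R u - b * (Φ u - Φ (u - 1)) with hΨ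
  have hΨeq : ∀ u : ℝ, β ≤ u → sieveInnerProduct b R r u = Ψ u := by
    intro u hu
    have hu0 : 0 < u := by linarith
    simp only [hΨ, hΦ, sieveInnerProduct]
    rw [intervalIntegral.integral_interval_sub_left (hgi hβ1 hu0) (hgi hβ1 (by linarith))]
  -- continuity of `Ψ` on `[β, ∞)`
  have hΨc : ∀ u : ℝ, β ≤ u → ContinuousAt Ψ u := by
    intro u hu
    have hu0 : 0 < u := by linarith
    have h1 : ContinuousAt (fun t : ℝ => t * r t * R t) u :=
      (continuousAt_id.mul (hrc.continuousAt (Ioi_mem_nhds hu0))).mul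
        (hRc.continuousAt (Ioi_mem_nhds hu0))
    have h2 : ContinuousAt Φ u := (hΦd u hu0).continuousAt
    have h3 : ContinuousAt (fun t : ℝ => Φ (t - 1)) u :=
      (HasDerivAt.comp_sub_const u 1 (hΦd (u - 1) (by linarith))).continuousAt
    exact h1.sub ((h2.sub h3).const_mul b)
  -- the derivative of `Ψ` vanishes on `(β, ∞) \ {β + 1}`
  have hΨd : ∀ t : ℝ, β < t → t ≠ β + 1 → HasDerivAt Ψ 0 t := by
    intro t ht ht1
    have ht0 : 0 < t := by linarith
    -- `t r(t) R(t) = (t^{1-a} r t) (t^a R t)` near `t`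
    have hprod : HasDerivAt (fun u : ℝ => u * r u * R u)
        (b * t ^ (-a) * r (t + 1) * (t ^ a * R t) +
          t ^ (1 - a) * r t * (-b * t ^ (a - 1) * R (t - 1))) t := by
      refine ((hr t ht0).mul (hR t ht ht1)).congr_of_eventuallyEq ?_
      filter_upwards [Ioi_mem_nhds ht0] with u (hu : 0 < u)
      show u * r u * R u = u ^ (1 - a) * r u * (u ^ a * R u)
      calc u * r u * R u = u ^ (1 - a) * u ^ a * r u * R u := by
            rw [← Real.rpow_add hu]; norm_num
        _ = u ^ (1 - a) * r u * (u ^ a * R u) := by ring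
    have hΦ1 : HasDerivAt (fun u : ℝ => Φ (u - 1)) (g (t - 1)) t :=
      HasDerivAt.comp_sub_const t 1 (hΦd (t - 1) (by linarith))
    have hall := hprod.sub (((hΦd t ht0).sub hΦ1).const_mul b)
    refine hall.congr_deriv ?_
    have e1 : t ^ (-a) * t ^ a = 1 := by
      rw [← Real.rpow_add ht0]; simp
    have e2 : t ^ (1 - a) * t ^ (a - 1) = 1 := by
      rw [← Real.rpow_add ht0]; norm_num
    simp only [hg, sub_add_cancel]
    linear_combination (b * r (t + 1) * R t) * e1 - (b * r t * R (t - 1)) * e2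
  -- constancy
  have hconst : Ψ s = Ψ β := eq_of_hasDerivAt_zero_off (by linarith : β < β + 1) hΨc hΨd hs
  -- evaluation at `β`
  have hβ0 : 0 < β := by linarith
  have hRβ : R β = A * β ^ (-a) := hR0 β ⟨hβ0, le_rfl⟩
  have hderiv : ∀ x ∈ uIcc (β - 1) β,
      HasDerivAt (fun u : ℝ => u ^ (1 - a) * r u) (b * x ^ (-a) * r (x + 1)) x := by
    intro x hx
    rw [Set.uIcc_of_le (by linarith)] at hx
    exact hr x (by linarith [hx.1])
  have hcont' : ContinuousOn (fun x : ℝ => b * x ^ (-a) * r (x + 1)) (Ioi 0) := by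
    refine (continuousOn_const.mul ?_).mul ?_
    · exact fun x (hx : 0 < x) =>
        (Real.continuousAt_rpow_const _ _ (Or.inl hx.ne')).continuousWithinAt
    · refine hrc.comp (continuousOn_id.add continuousOn_const) fun x (hx : 0 < x) => ?_
      show 0 < x + 1
      linarith
  have hint : IntervalIntegrable (fun x : ℝ => b * x ^ (-a) * r (x + 1)) volume (β - 1) β := by
    refine (hcont'.mono fun x hx => ?_).intervalIntegrable
    exact lt_of_lt_of_le (lt_min hβ1 hβ0) hx.1
  have hFTC := intervalIntegral.integral_eq_sub_of_hasDerivAt hderiv hint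
  have hIg : ∫ x in (β - 1)..β, g x = ∫ x in (β - 1)..β, r (x + 1) * (A * x ^ (-a)) := by
    refine intervalIntegral.integral_congr fun x hx => ?_
    rw [Set.uIcc_of_le (by linarith)] at hx
    simp only [hg]
    rw [hR0 x ⟨by linarith [hx.1], hx.2⟩]
  have hIg' : b * ∫ x in (β - 1)..β, g x =
      A * (β ^ (1 - a) * r β - (β - 1) ^ (1 - a) * r (β - 1)) := by
    rw [hIg, ← hFTC, ← intervalIntegral.integral_const_mul, ← intervalIntegral.integral_const_mul]
    refine intervalIntegral.integral_congr fun x _ => ?_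
    show b * (r (x + 1) * (A * x ^ (-a))) = A * (b * x ^ (-a) * r (x + 1))
    ring
  have hΦβ : Φ β - Φ (β - 1) = ∫ x in (β - 1)..β, g x := by
    simp only [hΦ, intervalIntegral.integral_same, sub_zero]
  have hΨβ : Ψ β = A * (β - 1) ^ (1 - a) * r (β - 1) := by
    simp only [hΨ]
    rw [hΦβ, hIg', hRβ]
    have e3 : β * β ^ (-a) = β ^ (1 - a) := by
      rw [sub_eq_add_neg, Real.rpow_add hβ0, Real.rpow_one]
    linear_combination (A * r β) * e3
  rw [hΨeq s hs, hconst, hΨβ]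

/-! ### The inner products of `Q = F − f` and `P = F + f` -/

namespace IsBetaSieveSolution

variable {κ : ℝ} {F f : ℝ → ℝ} {β A : ℝ}

/-- For a solution of the `β`-sieve system with `β > 1`, on `(β, β + 1)` the function
`u ↦ u^κ F(u)` is locally constant (`= A`), hence has derivative `0`. [folklore] -/
theorem hasDerivAt_upper_zero (h : IsBetaSieveSolution κ F f β A) {t : ℝ} (ht0 : 0 < t)
    (ht : t < β + 1) : HasDerivAt (fun u : ℝ => u ^ κ * F u) 0 t := by
  refine (hasDerivAt_const t A).congr_of_eventuallyEq ?_
  filter_upwards [Ioo_mem_nhds ht0 ht] with u hu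
  rw [h.upper_eq u ⟨hu.1, hu.2.le⟩, mul_left_comm, ← Real.rpow_add hu.1, add_neg_cancel,
    Real.rpow_zero, mul_one]

/-- The delay equation for `Q = F − f`: `(u^κ Q(u))' = −κ u^{κ−1} Q(u − 1)` for `u > β`,
`u ≠ β + 1` (given `β > 1`) [Greaves2001, §4.2.1 (1.9)]. [cite: Greaves2001, §4.2.1 (1.9)] -/
theorem hasDerivAt_sub (h : IsBetaSieveSolution κ F f β A) (hβ : 1 < β) {t : ℝ} (ht : β < t)
    (ht1 : t ≠ β + 1) :
    HasDerivAt (fun u : ℝ => u ^ κ * (F u - f u))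
      (-κ * t ^ (κ - 1) * (F (t - 1) - f (t - 1))) t := by
  have hfun : (fun u : ℝ => u ^ κ * (F u - f u)) = fun u => u ^ κ * F u - u ^ κ * f u := by
    funext u; ring
  rw [hfun]
  rcases lt_or_gt_of_ne ht1 with hlt | hgt
  · have hf0 : f (t - 1) = 0 := h.lower_eq (t - 1) ⟨by linarith, by linarith⟩
    refine ((h.hasDerivAt_upper_zero (by linarith) hlt).sub (h.hasDerivAt_lower t ht)).congr_deriv
      ?_
    rw [hf0]; ring
  · refine ((h.hasDerivAt_upper t hgt).sub (h.hasDerivAt_lower t ht)).congr_deriv ?_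
    ring

/-- The delay equation for `P = F + f`: `(u^κ P(u))' = κ u^{κ−1} P(u − 1)` for `u > β`,
`u ≠ β + 1` (given `β > 1`) [Greaves2001, §4.2.1 (1.9)]. [cite: Greaves2001, §4.2.1 (1.9)] -/
theorem hasDerivAt_add (h : IsBetaSieveSolution κ F f β A) (hβ : 1 < β) {t : ℝ} (ht : β < t)
    (ht1 : t ≠ β + 1) :
    HasDerivAt (fun u : ℝ => u ^ κ * (F u + f u))
      (-(-κ) * t ^ (κ - 1) * (F (t - 1) + f (t - 1))) t := by
  have hfun : (fun u : ℝ => u ^ κ * (F u + f u)) = fun u => u ^ κ * F u + u ^ κ * f u := by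
    funext u; ring
  rw [hfun]
  rcases lt_or_gt_of_ne ht1 with hlt | hgt
  · have hf0 : f (t - 1) = 0 := h.lower_eq (t - 1) ⟨by linarith, by linarith⟩
    refine ((h.hasDerivAt_upper_zero (by linarith) hlt).add (h.hasDerivAt_lower t ht)).congr_deriv
      ?_
    rw [hf0]; ring
  · refine ((h.hasDerivAt_upper t hgt).add (h.hasDerivAt_lower t ht)).congr_deriv ?_
    ring

/-- `Q = F − f` equals `A x^{−κ}` on `(0, β]`. [folklore] -/
theorem sub_eq_of_mem_Ioc (h : IsBetaSieveSolution κ F f β A) {x : ℝ} (hx : x ∈ Ioc 0 β) :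
    F x - f x = A * x ^ (-κ) := by
  rw [h.upper_eq x ⟨hx.1, by linarith [hx.2]⟩, h.lower_eq x hx, sub_zero]

/-- `P = F + f` equals `A x^{−κ}` on `(0, β]`. [folklore] -/
theorem add_eq_of_mem_Ioc (h : IsBetaSieveSolution κ F f β A) {x : ℝ} (hx : x ∈ Ioc 0 β) :
    F x + f x = A * x ^ (-κ) := by
  rw [h.upper_eq x ⟨hx.1, by linarith [hx.2]⟩, h.lower_eq x hx, add_zero]

/-- **The inner product `⟨Q, q⟩`** [Greaves2001, §4.2.4 (4.2) and (4.7) with `B = 0`, `C = A`]: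
for a solution of the `β`-sieve system with `β > 1` and any solution `q` of the adjoint equation
`(s q)' = κ q(s) + κ q(s + 1)` on `(0, ∞)`,
`s q(s) Q(s) − κ ∫_{s−1}^{s} q(x + 1) Q(x) dx = A (β − 1)^{1−κ} q(β − 1)` for all `s ≥ β`.
[cite: Greaves2001, Lemma 4.2.1 and §4.2.4 (4.7)] -/
theorem sieveInnerProduct_sub_eq (h : IsBetaSieveSolution κ F f β A) (hβ : 1 < β) {q : ℝ → ℝ}
    (hq : IsSieveAdjoint κ κ q) {s : ℝ} (hs : β ≤ s) :
    sieveInnerProduct κ (fun x => F x - f x) q s = A * (β - 1) ^ (1 - κ) * q (β - 1) :=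
  sieveInnerProduct_eq hβ hq (h.continuousOn_upper.sub h.continuousOn_lower)
    (fun _ hx => h.sub_eq_of_mem_Ioc hx) (fun _ ht ht1 => h.hasDerivAt_sub hβ ht ht1) hs

/-- **The inner product `⟨P, p⟩`** [Greaves2001, §4.2.4 (4.4) and (4.7) with `B = 0`, `C = A`]:
for a solution of the `β`-sieve system with `β > 1` and any solution `p` of the adjoint equation
`(s p)' = κ p(s) − κ p(s + 1)` on `(0, ∞)`,
`s p(s) P(s) + κ ∫_{s−1}^{s} p(x + 1) P(x) dx = A (β − 1)^{1−κ} p(β − 1)` for all `s ≥ β`.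
[cite: Greaves2001, Lemma 4.2.1 and §4.2.4 (4.7)] -/
theorem sieveInnerProduct_add_eq (h : IsBetaSieveSolution κ F f β A) (hβ : 1 < β) {p : ℝ → ℝ}
    (hp : IsSieveAdjoint κ (-κ) p) {s : ℝ} (hs : β ≤ s) :
    sieveInnerProduct (-κ) (fun x => F x + f x) p s = A * (β - 1) ^ (1 - κ) * p (β - 1) :=
  sieveInnerProduct_eq hβ hp (h.continuousOn_upper.add h.continuousOn_lower)
    (fun _ hx => h.add_eq_of_mem_Ioc hx) (fun _ ht ht1 => h.hasDerivAt_add hβ ht ht1) hs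

/-! ### Necessity of `q(β − 1) = 0` and the value of `A` -/

/-- **Necessity of the sifting-limit equation** [Greaves2001, §4.2.4: (4.7) with `B = 0` forces
`q(β − 1) = 0`, cf. (4.10) and the proof of Lemma 4.2.5 (i)]: if `(F, f, β, A)` is a NORMALISED
solution of the `β`-sieve system (`F, f = 1 + O(e^{−s})`) with `β > 1`, then every solution `q` of
the adjoint equation `(s q)' = κ q(s) + κ q(s + 1)` on `(0, ∞)` of polynomial growth vanishes at
`β − 1`. (The inner product `⟨F − f, q⟩(s)` is constant, equal to `A (β − 1)^{1−κ} q(β − 1)`, and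
tends to `0`.) In particular `β − 1` is a zero of Iwaniec's `q_κ ∼ s^{2κ−1}`.
[cite: Greaves2001, §4.2.4 (4.7) and (4.10)] -/
theorem adjoint_apply_eq_zero (h : IsBetaSieveSolution κ F f β A) (hβ : 1 < β) {q : ℝ → ℝ}
    (hq : IsSieveAdjoint κ κ q) (hqO : ∃ N : ℝ, q =O[atTop] fun s : ℝ => s ^ N) :
    q (β - 1) = 0 := by
  obtain ⟨N₀, hN₀⟩ := hqO
  -- w.l.o.g. the exponent is nonnegative
  set N : ℝ := max N₀ 0 with hNdef
  have hN0 : 0 ≤ N := le_max_right _ _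
  have hqN : q =O[atTop] fun s : ℝ => s ^ N := by
    refine hN₀.trans (IsBigO.of_bound 1 ?_)
    filter_upwards [eventually_ge_atTop (1 : ℝ)] with s hs
    rw [one_mul, Real.norm_of_nonneg (Real.rpow_nonneg (by linarith) _),
      Real.norm_of_nonneg (Real.rpow_nonneg (by linarith) _)]
    exact Real.rpow_le_rpow_of_exponent_le hs (le_max_left _ _)
  have hQ : (fun s : ℝ => F s - f s) =O[atTop] fun s : ℝ => Real.exp (-s) := by
    have := h.upper_isBigO.sub h.lower_isBigO
    refine this.congr_left fun s => ?_
    ring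
  -- the constant value of the inner product
  set c : ℝ := A * (β - 1) ^ (1 - κ) * q (β - 1) with hc
  have hIP : ∀ s : ℝ, β ≤ s → sieveInnerProduct κ (fun x => F x - f x) q s = c :=
    fun s hs => h.sieveInnerProduct_sub_eq hβ hq hs
  -- first term: `s q(s) Q(s) → 0`
  have hT1 : Tendsto (fun s : ℝ => s * q s * (F s - f s)) atTop (𝓝 0) := by
    have h1 : (fun s : ℝ => s * q s) =O[atTop] fun s : ℝ => s ^ (N + 1) := by
      refine ((isBigO_refl (fun s : ℝ => s) atTop).mul hqN).trans_eventuallyEq ?_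
      filter_upwards [eventually_gt_atTop (0 : ℝ)] with s hs
      rw [Real.rpow_add_one hs.ne', mul_comm]
    have h2 := h1.mul hQ
    refine h2.trans_tendsto ?_
    simpa [neg_mul, one_mul] using tendsto_rpow_mul_exp_neg_mul_atTop_nhds_zero (N + 1) 1 one_pos
  -- second term: the integral over `[s - 1, s]` tends to `0`
  have hT2 : Tendsto (fun s : ℝ => ∫ x in (s - 1)..s, q (x + 1) * (F x - f x)) atTop (𝓝 0) := by
    obtain ⟨C₁, hC₁0, hC₁⟩ := hQ.exists_pos
    obtain ⟨C₂, hC₂0, hC₂⟩ := hqN.exists_pos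
    obtain ⟨x₁, hx₁⟩ := eventually_atTop.mp hC₁.bound
    obtain ⟨x₂, hx₂⟩ := eventually_atTop.mp hC₂.bound
    -- bound of the integrand on `[s - 1, s]` for large `s`
    set M : ℝ → ℝ := fun s => C₂ * (s + 1) ^ N * (C₁ * Real.exp (-(s - 1))) with hM
    have hbound : ∀ᶠ s : ℝ in atTop,
        ‖∫ x in (s - 1)..s, q (x + 1) * (F x - f x)‖ ≤ M s * |s - (s - 1)| := by
      filter_upwards [eventually_ge_atTop (max (max x₁ x₂) 0 + 1)] with s hs
      refine intervalIntegral.norm_integral_le_of_norm_le_const fun x hx => ?_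
      rw [Set.uIoc_of_le (by linarith)] at hx
      have hxx₁ : x₁ ≤ x := by
        linarith [hx.1, le_max_left x₁ x₂, le_max_left (max x₁ x₂) 0]
      have hxx₂ : x₂ ≤ x + 1 := by
        linarith [hx.1, le_max_right x₁ x₂, le_max_left (max x₁ x₂) 0]
      have hx0 : 0 ≤ x := by linarith [hx.1, le_max_right (max x₁ x₂) 0]
      have hq' := hx₂ (x + 1) hxx₂
      have hQ' := hx₁ x hxx₁
      rw [Real.norm_of_nonneg (Real.rpow_nonneg (by linarith) _)] at hq'
      rw [Real.norm_of_nonneg (Real.exp_pos _).le] at hQ'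
      rw [norm_mul]
      have hC₂x : 0 ≤ C₂ * (x + 1) ^ N := (norm_nonneg _).trans hq'
      calc ‖q (x + 1)‖ * ‖F x - f x‖
          ≤ C₂ * (x + 1) ^ N * (C₁ * Real.exp (-x)) :=
            mul_le_mul hq' hQ' (norm_nonneg _) hC₂x
        _ ≤ C₂ * (s + 1) ^ N * (C₁ * Real.exp (-(s - 1))) := by
            have hs1 : 0 ≤ (s + 1) ^ N := Real.rpow_nonneg (by linarith [hx.1, hx.2]) _
            refine mul_le_mul ?_ ?_ (mul_nonneg hC₁0.le (Real.exp_pos _).le)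
              (mul_nonneg hC₂0.le hs1)
            · exact mul_le_mul_of_nonneg_left
                (Real.rpow_le_rpow (by linarith) (by linarith [hx.2]) hN0) hC₂0.le
            · exact mul_le_mul_of_nonneg_left (Real.exp_le_exp.mpr (by linarith [hx.1])) hC₁0.le
    have hM0 : Tendsto (fun s : ℝ => M s * |s - (s - 1)|) atTop (𝓝 0) := by
      have hsimp : (fun s : ℝ => M s * |s - (s - 1)|) =
          fun s => (C₂ * C₁ * Real.exp 2) * ((s + 1) ^ N * Real.exp (-1 * (s + 1))) := by
        funext s
        simp only [hM, sub_sub_cancel, abs_one, mul_one]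
        have : Real.exp (-(s - 1)) = Real.exp 2 * Real.exp (-1 * (s + 1)) := by
          rw [← Real.exp_add]; ring_nf
        rw [this]; ring
      rw [hsimp]
      have hlim := (tendsto_rpow_mul_exp_neg_mul_atTop_nhds_zero N 1 one_pos).comp
        (tendsto_atTop_add_const_right atTop (1 : ℝ) tendsto_id)
      simpa using hlim.const_mul (C₂ * C₁ * Real.exp 2)
    exact squeeze_zero_norm' hbound hM0
  -- the inner product tends to `0`, but is eventually the constant `c`
  have hT : Tendsto (fun s : ℝ => sieveInnerProduct κ (fun x => F x - f x) q s) atTop (𝓝 0) := by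
    have := hT1.sub (hT2.const_mul κ)
    simpa [sieveInnerProduct] using this
  have hcT : Tendsto (fun s : ℝ => sieveInnerProduct κ (fun x => F x - f x) q s) atTop (𝓝 c) :=
    (tendsto_const_nhds (x := c)).congr'
      (by filter_upwards [eventually_ge_atTop β] with s hs; exact (hIP s hs).symm)
  have hc0 : c = 0 := tendsto_nhds_unique hcT hT
  have hpos : 0 < A * (β - 1) ^ (1 - κ) := mul_pos h.pos (Real.rpow_pos_of_pos (by linarith) _)
  rcases mul_eq_zero.mp hc0 with h0 | h0
  · exact absurd h0 hpos.ne'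
  · exact h0

/-- **The constant `A`** [Greaves2001, Lemma 4.2.5 (4.11): `C = 2 (β − 1)^{κ−1} / p(β − 1)`]:
if `(F, f, β, A)` solves the normalised `β`-sieve system with `β > 1` and `p` is a solution of
the adjoint equation `(s p)' = κ p(s) − κ p(s + 1)` on `(0, ∞)` with Iwaniec's normalisation
`s p(s) → 1`, then `A (β − 1)^{1−κ} p(β − 1) = 2` (the inner product `⟨F + f, p⟩` is constant and
tends to `2`). [cite: Greaves2001, Lemma 4.2.5 (4.11)] -/
theorem const_eq (h : IsBetaSieveSolution κ F f β A) (hβ : 1 < β) {p : ℝ → ℝ}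
    (hp : IsSieveAdjoint κ (-κ) p) (hp1 : Tendsto (fun s : ℝ => s * p s) atTop (𝓝 1)) :
    A * (β - 1) ^ (1 - κ) * p (β - 1) = 2 := by
  set c : ℝ := A * (β - 1) ^ (1 - κ) * p (β - 1) with hc
  have hIP : ∀ s : ℝ, β ≤ s → sieveInnerProduct (-κ) (fun x => F x + f x) p s = c :=
    fun s hs => h.sieveInnerProduct_add_eq hβ hp hs
  have hP : Tendsto (fun s : ℝ => F s + f s) atTop (𝓝 2) := by
    have := h.tendsto_upper.add h.tendsto_lower
    norm_num at this
    exact this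
  -- first term `s p(s) P(s) → 2`
  have hT1 : Tendsto (fun s : ℝ => s * p s * (F s + f s)) atTop (𝓝 2) := by
    have := hp1.mul hP
    simpa using this
  -- second term: the integral tends to `0`
  have hT2 : Tendsto (fun s : ℝ => ∫ x in (s - 1)..s, p (x + 1) * (F x + f x)) atTop (𝓝 0) := by
    -- eventually `|u p(u)| ≤ 2` and `|P| ≤ 3`
    have hp2 : ∀ᶠ u : ℝ in atTop, |u * p u| ≤ 2 := by
      have := hp1.eventually (Icc_mem_nhds (by norm_num : (0 : ℝ) < 1) (by norm_num : (1 : ℝ) < 2))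
      filter_upwards [this] with u hu
      exact abs_le.mpr ⟨by linarith [hu.1], hu.2⟩
    have hP3 : ∀ᶠ u : ℝ in atTop, |F u + f u| ≤ 3 := by
      have := hP.eventually (Icc_mem_nhds (by norm_num : (1 : ℝ) < 2) (by norm_num : (2 : ℝ) < 3))
      filter_upwards [this] with u hu
      exact abs_le.mpr ⟨by linarith [hu.1], hu.2⟩
    obtain ⟨x₁, hx₁⟩ := eventually_atTop.mp hp2
    obtain ⟨x₂, hx₂⟩ := eventually_atTop.mp hP3
    have hbound : ∀ᶠ s : ℝ in atTop,
        ‖∫ x in (s - 1)..s, p (x + 1) * (F x + f x)‖ ≤ 6 / s * |s - (s - 1)| := by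
      filter_upwards [eventually_ge_atTop (max (max x₁ x₂) 0 + 1)] with s hs
      have hs0 : 0 < s := by linarith [le_max_right (max x₁ x₂) 0]
      refine intervalIntegral.norm_integral_le_of_norm_le_const fun x hx => ?_
      rw [Set.uIoc_of_le (by linarith)] at hx
      have hxx₁ : x₁ ≤ x + 1 := by
        linarith [hx.1, le_max_left x₁ x₂, le_max_left (max x₁ x₂) 0]
      have hxx₂ : x₂ ≤ x := by
        linarith [hx.1, le_max_right x₁ x₂, le_max_left (max x₁ x₂) 0]
      have hx0 : 0 < x + 1 := by linarith [hx.1, le_max_right (max x₁ x₂) 0]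
      have h1 := hx₁ (x + 1) hxx₁
      have h2 := hx₂ x hxx₂
      have hpx : |p (x + 1)| ≤ 2 / s := by
        rw [abs_mul, abs_of_pos hx0] at h1
        rw [le_div_iff₀ hs0]
        calc |p (x + 1)| * s ≤ |p (x + 1)| * (x + 1) :=
              mul_le_mul_of_nonneg_left (by linarith [hx.1]) (abs_nonneg _)
          _ = (x + 1) * |p (x + 1)| := by ring
          _ ≤ 2 := h1
      rw [norm_mul, Real.norm_eq_abs, Real.norm_eq_abs]
      calc |p (x + 1)| * |F x + f x| ≤ 2 / s * 3 :=
            mul_le_mul hpx h2 (abs_nonneg _) (by positivity)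
        _ = 6 / s := by ring
    have hM0 : Tendsto (fun s : ℝ => 6 / s * |s - (s - 1)|) atTop (𝓝 0) := by
      have : (fun s : ℝ => 6 / s * |s - (s - 1)|) = fun s => 6 * s⁻¹ := by
        funext s; simp [div_eq_mul_inv]
      rw [this]
      simpa using (tendsto_inv_atTop_zero).const_mul (6 : ℝ)
    exact squeeze_zero_norm' hbound hM0
  have hT : Tendsto (fun s : ℝ => sieveInnerProduct (-κ) (fun x => F x + f x) p s) atTop (𝓝 2) := by
    have := hT1.sub (hT2.const_mul (-κ))
    simpa [sieveInnerProduct] using this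
  have hcT : Tendsto (fun s : ℝ => sieveInnerProduct (-κ) (fun x => F x + f x) p s) atTop (𝓝 c) :=
    (tendsto_const_nhds (x := c)).congr'
      (by filter_upwards [eventually_ge_atTop β] with s hs; exact (hIP s hs).symm)
  exact tendsto_nhds_unique hcT hT

/-! ### `β > 1` for `κ ≥ 1` -/

/-- For `κ ≥ 1` every solution of the `β`-sieve system has `β > 1`: if `β = 1`, then
`(s^κ f(s))' = κ s^{κ−1} A (s − 1)^{−κ}` on `(1, 2)` is not integrable at `1⁺`, contradicting the
continuity of `f` at `1` with `f(1) = 0`. (For `1/2 < κ < 1` one has `β_κ > 1` as well, but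
`β = 1` is not excluded by this local argument; for `κ = 1/2`, `β = 1`.) [folklore] -/
theorem one_lt (h : IsBetaSieveSolution κ F f β A) (hκ : 1 ≤ κ) : 1 < β := by
  by_contra hβ
  have hβ1 : β = 1 := le_antisymm (not_lt.mp hβ) h.one_le
  have hA := h.pos
  -- `G u = u^κ f u`, with `G 1 = 0`, continuous on `[1, 3/2]`
  set G : ℝ → ℝ := fun u => u ^ κ * f u with hG
  have hG1 : G 1 = 0 := by
    simp only [hG, Real.one_rpow, one_mul]
    exact h.lower_eq 1 ⟨one_pos, by rw [hβ1]⟩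
  have hGc : ContinuousOn G (Icc 1 (3 / 2)) := by
    refine ContinuousOn.mul (fun u hu => ?_) (h.continuousOn_lower.mono fun u hu => ?_)
    · exact (Real.continuousAt_rpow_const _ _ (Or.inl (by linarith [hu.1]))).continuousWithinAt
    · exact lt_of_lt_of_le one_pos hu.1
  -- derivative of `G` on `(1, 3/2)`
  have hGd : ∀ u ∈ Ioo (1 : ℝ) (3 / 2),
      HasDerivAt G (κ * u ^ (κ - 1) * (A * (u - 1) ^ (-κ))) u := by
    intro u hu
    have := h.hasDerivAt_lower u (by rw [hβ1]; exact hu.1)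
    rwa [h.upper_eq (u - 1) ⟨by linarith [hu.1], by linarith [hu.2]⟩] at this
  -- lower bound for the derivative: `κ u^{κ-1} A (u-1)^{-κ} ≥ A / (u - 1)` on `(1, 3/2)`
  have hGd_ge : ∀ u ∈ Ioo (1 : ℝ) (3 / 2),
      A * (u - 1)⁻¹ ≤ κ * u ^ (κ - 1) * (A * (u - 1) ^ (-κ)) := by
    intro u hu
    have hu1 : 0 < u - 1 := by linarith [hu.1]
    have h1 : 1 ≤ u ^ (κ - 1) := Real.one_le_rpow (by linarith [hu.1]) (by linarith)
    have h2 : (u - 1)⁻¹ ≤ (u - 1) ^ (-κ) := by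
      rw [Real.rpow_neg hu1.le, inv_le_inv₀ hu1 (Real.rpow_pos_of_pos hu1 _)]
      calc (u - 1) ^ κ ≤ (u - 1) ^ (1 : ℝ) :=
            Real.rpow_le_rpow_of_exponent_ge hu1 (by linarith [hu.2]) hκ
        _ = u - 1 := Real.rpow_one _
    calc A * (u - 1)⁻¹ = 1 * 1 * (A * (u - 1)⁻¹) := by ring
      _ ≤ κ * u ^ (κ - 1) * (A * (u - 1) ^ (-κ)) := by
          refine mul_le_mul (mul_le_mul hκ h1 zero_le_one (by linarith)) ?_ (by positivity)
            (by positivity)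
          exact mul_le_mul_of_nonneg_left h2 hA.le
  -- `H u = G u - A log (u - 1)` is monotone on `(1, 3/2]`... we compare values directly:
  -- for `1 < x ≤ 3/2`: `G (3/2) - G x ≥ A (log (1/2) - log (x - 1))`
  have hmono : ∀ x ∈ Ioc (1 : ℝ) (3 / 2),
      A * (Real.log (3 / 2 - 1) - Real.log (x - 1)) ≤ G (3 / 2) - G x := by
    intro x hx
    -- apply the mean value inequality to `H u = G u - A log (u - 1)` on `[x, 3/2]`
    set H : ℝ → ℝ := fun u => G u - A * Real.log (u - 1) with hH
    have hHc : ContinuousOn H (Icc x (3 / 2)) := by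
      refine (hGc.mono fun u hu => ⟨by linarith [hu.1, hx.1], hu.2⟩).sub
        (continuousOn_const.mul (ContinuousOn.log (continuous_sub_right (1 : ℝ)).continuousOn
          fun u hu => ?_))
      exact (sub_pos.mpr (by linarith [hu.1, hx.1] : (1 : ℝ) < u)).ne'
    have hHd : ∀ u ∈ interior (Icc x (3 / 2)), HasDerivAt H
        (κ * u ^ (κ - 1) * (A * (u - 1) ^ (-κ)) - A * (u - 1)⁻¹) u := by
      intro u hu
      rw [interior_Icc] at hu
      have hu' : u ∈ Ioo (1 : ℝ) (3 / 2) := ⟨by linarith [hu.1, hx.1], hu.2⟩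
      refine (hGd u hu').sub ?_
      have hlog : HasDerivAt (fun u : ℝ => Real.log (u - 1)) ((u - 1)⁻¹) u := by
        have h1 : HasDerivAt (fun u : ℝ => u - 1) 1 u := (hasDerivAt_id u).sub_const 1
        have h2 := h1.log (sub_pos.mpr hu'.1).ne'
        simpa using h2
      simpa using hlog.const_mul A
    have hHmono : MonotoneOn H (Icc x (3 / 2)) := by
      refine monotoneOn_of_deriv_nonneg (convex_Icc _ _) hHc
        (fun u hu => (hHd u hu).differentiableAt.differentiableWithinAt) fun u hu => ?_
      rw [(hHd u hu).deriv]
      rw [interior_Icc] at hu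
      have := hGd_ge u ⟨by linarith [hu.1, hx.1], hu.2⟩
      linarith
    have := hHmono ⟨le_rfl, hx.2⟩ ⟨hx.2, le_rfl⟩ hx.2
    simp only [hH] at this
    linarith
  -- `G x ≥ 0 = G 1` for `x ∈ [1, 3/2]` (monotonicity of `G`)
  have hGmono : MonotoneOn G (Icc 1 (3 / 2)) := by
    refine monotoneOn_of_deriv_nonneg (convex_Icc _ _) hGc
      (fun u hu => ?_) fun u hu => ?_
    · rw [interior_Icc] at hu
      exact (hGd u hu).differentiableAt.differentiableWithinAt
    · rw [interior_Icc] at hu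
      rw [(hGd u hu).deriv]
      have hu1 : 0 < u - 1 := by linarith [hu.1]
      have : 0 < u := by linarith [hu.1]
      positivity
  -- choose `x` close to `1` with `A log (x - 1)` very negative
  set K : ℝ := G (3 / 2) - A * Real.log (3 / 2 - 1) with hK
  -- `x = 1 + exp (-(K + 1) / A) / 2`, truncated to lie in `(1, 3/2]`
  set ε : ℝ := min (Real.exp (-(K + 1) / A)) (1 / 2) with hε
  have hε0 : 0 < ε := lt_min (Real.exp_pos _) (by norm_num)
  have hε1 : ε ≤ 1 / 2 := min_le_right _ _
  have hεe : ε ≤ Real.exp (-(K + 1) / A) := min_le_left _ _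
  set x : ℝ := 1 + ε with hxdef
  have hx : x ∈ Ioc (1 : ℝ) (3 / 2) := ⟨by rw [hxdef]; linarith, by rw [hxdef]; linarith⟩
  have hlogx : Real.log (x - 1) ≤ -(K + 1) / A := by
    rw [hxdef, add_sub_cancel_left]
    calc Real.log ε ≤ Real.log (Real.exp (-(K + 1) / A)) := Real.log_le_log hε0 hεe
      _ = -(K + 1) / A := Real.log_exp _
  have h1 := hmono x hx
  have h2 : 0 ≤ G x := by
    have := hGmono ⟨le_rfl, by norm_num⟩ ⟨hx.1.le, hx.2⟩ hx.1.le
    rwa [hG1] at this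
  -- `G x ≤ K + A log (x - 1) ≤ K - (K + 1) = -1 < 0`
  have h3 : A * Real.log (x - 1) ≤ -(K + 1) := by
    have := mul_le_mul_of_nonneg_left hlogx hA.le
    rwa [mul_div_cancel₀ _ hA.ne'] at this
  have h4 : G x ≤ K + A * Real.log (x - 1) := by rw [hK]; linarith
  linarith

/-! ### Polynomial adjoints [Greaves2001, §4.2.3 (3.3)] and consequences -/

/-- `q_{1/2} = 1` solves the adjoint equation of dimension `1/2`:
`(s^{1/2})' = (1/2) s^{−1/2}` [Greaves2001, §4.2.3 (3.3)]. [cite: Greaves2001, §4.2.3 (3.3)] -/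
theorem _root_.Literature.NumberTheory.Sieve.isSieveAdjoint_half : IsSieveAdjoint (1 / 2) (1 / 2) fun _ => 1 := by
  intro s hs
  have h := Real.hasDerivAt_rpow_const (x := s) (p := 1 - 1 / 2) (Or.inl hs.ne')
  simp only [mul_one]
  refine h.congr_deriv ?_
  norm_num

/-- `q_1(s) = s − 1` solves the adjoint equation of dimension `1`:
`(s − 1)' = 1 = s^{−1} ((s + 1) − 1)` [Greaves2001, §4.2.3 (3.3)]. [cite: Greaves2001, §4.2.3 (3.3)] -/
theorem _root_.Literature.NumberTheory.Sieve.isSieveAdjoint_one : IsSieveAdjoint 1 1 fun s => s - 1 := by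
  intro s hs
  have hfun : (fun t : ℝ => t ^ ((1 : ℝ) - 1) * (t - 1)) = fun t => t - 1 := by
    funext t; simp
  rw [hfun]
  refine ((hasDerivAt_id s).sub_const 1).congr_deriv ?_
  rw [Real.rpow_neg_one]
  field_simp
  ring

/-- `q_2(s) = s³ − 6s² + 9s − 8/3` solves the adjoint equation of dimension `2`
[Greaves2001, §4.2.3 (3.3)]: `(s^{−1} q_2(s))' = 2 s^{−2} q_2(s + 1)`. Its positive zeros are
`0.39209`, `1.77393`, `3.83399` (numerically). [cite: Greaves2001, §4.2.3 (3.3)] -/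
theorem _root_.Literature.NumberTheory.Sieve.isSieveAdjoint_two :
    IsSieveAdjoint 2 2 fun s => s ^ 3 - 6 * s ^ 2 + 9 * s - 8 / 3 := by
  intro s hs
  have hfun : (fun t : ℝ => t ^ ((1 : ℝ) - 2) * (t ^ 3 - 6 * t ^ 2 + 9 * t - 8 / 3)) =
      fun t => t⁻¹ * (t ^ 3 - 6 * t ^ 2 + 9 * t - 8 / 3) := by
    funext t
    rw [show (1 : ℝ) - 2 = -1 by norm_num, Real.rpow_neg_one]
  rw [hfun]
  have hpoly : HasDerivAt (fun t : ℝ => t ^ 3 - 6 * t ^ 2 + 9 * t - 8 / 3)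
      (3 * s ^ 2 - 12 * s + 9) s := by
    have h3 := hasDerivAt_pow 3 s
    have h2 := hasDerivAt_pow 2 s
    have h1 := hasDerivAt_id s
    have := ((h3.sub (h2.const_mul 6)).add (h1.const_mul 9)).sub_const (8 / 3)
    refine (this.congr_of_eventuallyEq (Eventually.of_forall fun t => ?_)).congr_deriv ?_
    · simp only [Pi.add_apply, Pi.sub_apply, id_eq]
    · push_cast
      ring
  refine ((hasDerivAt_inv hs.ne').mul hpoly).congr_deriv ?_
  rw [Real.rpow_neg hs.le, Real.rpow_two]
  field_simp
  ring

/-- `q_{3/2}(s) = s² − 3s + 3/2` solves the adjoint equation of dimension `3/2`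
[Greaves2001, §4.2.3 (3.3)]: `(s^{−1/2} q_{3/2}(s))' = (3/2) s^{−3/2} q_{3/2}(s + 1)`. Its zeros are
`(3 ∓ √3)/2 = 0.63397, 2.36603`. [cite: Greaves2001, §4.2.3 (3.3)] -/
theorem _root_.Literature.NumberTheory.Sieve.isSieveAdjoint_three_halves :
    IsSieveAdjoint (3 / 2) (3 / 2) fun s => s ^ 2 - 3 * s + 3 / 2 := by
  intro s hs
  have h1 : HasDerivAt (fun t : ℝ => t ^ ((1 : ℝ) - 3 / 2)) ((1 - 3 / 2) * s ^ ((1 : ℝ) - 3 / 2 - 1)) s :=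
    Real.hasDerivAt_rpow_const (Or.inl hs.ne')
  have hpoly : HasDerivAt (fun t : ℝ => t ^ 2 - 3 * t + 3 / 2) (2 * s - 3) s := by
    have h2 := hasDerivAt_pow 2 s
    have h1' := hasDerivAt_id s
    have := ((h2.sub (h1'.const_mul 3)).add_const (3 / 2))
    refine (this.congr_of_eventuallyEq (Eventually.of_forall fun t => ?_)).congr_deriv ?_
    · simp only [Pi.sub_apply, id_eq]
    · push_cast
      ring
  refine ((h1.mul hpoly).congr_of_eventuallyEq (Eventually.of_forall fun t => rfl)).congr_deriv ?_
  have e1 : s ^ ((1 : ℝ) - 3 / 2 - 1) = s ^ (-(3 / 2 : ℝ)) := by norm_num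
  have e2 : s ^ ((1 : ℝ) - 3 / 2) = s * s ^ (-(3 / 2 : ℝ)) := by
    rw [show (1 : ℝ) - 3 / 2 = 1 + -(3 / 2) by norm_num, Real.rpow_add hs, Real.rpow_one]
  rw [e1, e2]
  ring

/-- Polynomials have polynomial growth: `q_1 = O(s)`. [folklore] -/
theorem _root_.Literature.NumberTheory.Sieve.isBigO_adjoint_one : (fun s : ℝ => s - 1) =O[atTop] fun s : ℝ => s ^ (1 : ℝ) := by
  refine IsBigO.of_bound 1 ?_
  filter_upwards [eventually_ge_atTop (1 : ℝ)] with s hs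
  rw [Real.rpow_one, one_mul, Real.norm_eq_abs, Real.norm_eq_abs, abs_of_nonneg (by linarith),
    abs_of_nonneg (by linarith)]
  linarith

/-- Polynomials have polynomial growth: `q_2 = O(s³)`. [folklore] -/
theorem _root_.Literature.NumberTheory.Sieve.isBigO_adjoint_two :
    (fun s : ℝ => s ^ 3 - 6 * s ^ 2 + 9 * s - 8 / 3) =O[atTop] fun s : ℝ => s ^ (3 : ℝ) := by
  refine IsBigO.of_bound 20 ?_
  filter_upwards [eventually_ge_atTop (1 : ℝ)] with s hs
  rw [show (3 : ℝ) = ((3 : ℕ) : ℝ) by norm_num, Real.rpow_natCast, Real.norm_eq_abs,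
    Real.norm_eq_abs, abs_of_nonneg (by positivity : (0 : ℝ) ≤ s ^ 3)]
  refine abs_le.mpr ⟨?_, ?_⟩
  · nlinarith [pow_le_pow_left₀ (by linarith : (0 : ℝ) ≤ 1) hs 2,
      pow_le_pow_left₀ (by linarith : (0 : ℝ) ≤ 1) hs 3, sq_nonneg s]
  · nlinarith [pow_le_pow_left₀ (by linarith : (0 : ℝ) ≤ 1) hs 2,
      pow_le_pow_left₀ (by linarith : (0 : ℝ) ≤ 1) hs 3, sq_nonneg s,
      mul_nonneg (by linarith : (0 : ℝ) ≤ s) (sq_nonneg s)]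

/-- Polynomials have polynomial growth: `q_{3/2} = O(s²)`. [folklore] -/
theorem _root_.Literature.NumberTheory.Sieve.isBigO_adjoint_three_halves :
    (fun s : ℝ => s ^ 2 - 3 * s + 3 / 2) =O[atTop] fun s : ℝ => s ^ (2 : ℝ) := by
  refine IsBigO.of_bound 6 ?_
  filter_upwards [eventually_ge_atTop (1 : ℝ)] with s hs
  rw [Real.rpow_two, Real.norm_eq_abs, Real.norm_eq_abs, abs_of_nonneg (sq_nonneg s)]
  refine abs_le.mpr ⟨?_, ?_⟩
  · nlinarith [pow_le_pow_left₀ (by linarith : (0 : ℝ) ≤ 1) hs 2]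
  · nlinarith [pow_le_pow_left₀ (by linarith : (0 : ℝ) ≤ 1) hs 2]

/-- **Dimension `1/2`: every normalised solution has `β = 1`.** The adjoint is `q_{1/2} = 1`
[Greaves2001, (3.3)], which has no zeros, so `β > 1` is impossible (`adjoint_apply_eq_zero`);
with `β ≥ 1` this gives `β = 1 = β_{1/2}` [Greaves2001, (4.2.4.10)].
[cite: Greaves2001, §4.2.4 (4.10)] -/
theorem beta_eq_one {F f : ℝ → ℝ} {β A : ℝ} (h : IsBetaSieveSolution (1 / 2) F f β A) : β = 1 := by
  by_contra hne
  have hβ : 1 < β := lt_of_le_of_ne h.one_le (Ne.symm hne)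
  have hO : (fun _ : ℝ => (1 : ℝ)) =O[atTop] fun s : ℝ => s ^ (0 : ℝ) :=
    IsBigO.of_bound 1 (Eventually.of_forall fun s => by simp)
  have h0 : (1 : ℝ) = 0 := h.adjoint_apply_eq_zero hβ isSieveAdjoint_half ⟨0, hO⟩
  exact one_ne_zero h0

/-- **Dimension `3/2`: every normalised solution has `β = (5 ± √3)/2`** (`= 1.63397` or
`3.36603`), the roots of `q_{3/2}(β − 1) = (β − 1)² − 3(β − 1) + 3/2 = 0` [Greaves2001, (3.3),
(4.2.4.7)]; the `β`-sieve takes the greater, `β_{3/2} = (5 + √3)/2` [Greaves2001, (4.2.4.10)].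
[cite: Greaves2001, §4.2.3 (3.3) and §4.2.4 (4.7), (4.10)] -/
theorem beta_eq_of_three_halves {F f : ℝ → ℝ} {β A : ℝ} (h : IsBetaSieveSolution (3 / 2) F f β A) :
    β = (5 - Real.sqrt 3) / 2 ∨ β = (5 + Real.sqrt 3) / 2 := by
  have hq : (β - 1) ^ 2 - 3 * (β - 1) + 3 / 2 = 0 :=
    h.adjoint_apply_eq_zero (h.one_lt (by norm_num)) isSieveAdjoint_three_halves
      ⟨2, isBigO_adjoint_three_halves⟩
  have h3 : Real.sqrt 3 ^ 2 = 3 := Real.sq_sqrt (by norm_num)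
  have hsq : (2 * β - 5) ^ 2 = Real.sqrt 3 ^ 2 := by rw [h3]; nlinarith [hq]
  rcases eq_or_eq_neg_of_sq_eq_sq _ _ hsq with h1 | h1
  · right; linarith
  · left; linarith

/-- **Linear sieve: every normalised solution has `β = 2`.** For `κ = 1` the adjoint is
`q_1(s) = s − 1` [Greaves2001, (3.3)], so `q_1(β − 1) = 0` forces `β = 2` [Greaves2001, §4.2.4
(4.8)–(4.9) with `B = 0`]; and `β > 1` by `one_lt`. [cite: Greaves2001, §4.2.4 (4.8)–(4.10)] -/
theorem beta_eq_two {F f : ℝ → ℝ} {β A : ℝ} (h : IsBetaSieveSolution 1 F f β A) : β = 2 := by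
  have hβ := h.one_lt le_rfl
  have h0 : β - 1 - 1 = 0 := h.adjoint_apply_eq_zero hβ isSieveAdjoint_one ⟨1, isBigO_adjoint_one⟩
  linarith

/-- **Dimension `2`: `β − 1` is a zero of `q_2(s) = s³ − 6s² + 9s − 8/3`** for every normalised
solution of the `β`-sieve system of dimension `2` (so, numerically,
`β ∈ {1.39209, 2.77393, 4.83399}`; the `β`-sieve takes the greatest, `β_2 = 4.83399`
[Greaves2001, (4.2.4.10)]). [cite: Greaves2001, §4.2.3 (3.3) and §4.2.4 (4.7), (4.10)] -/
theorem cubic_eq_zero {F f : ℝ → ℝ} {β A : ℝ} (h : IsBetaSieveSolution 2 F f β A) :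
    (β - 1) ^ 3 - 6 * (β - 1) ^ 2 + 9 * (β - 1) - 8 / 3 = 0 :=
  h.adjoint_apply_eq_zero (h.one_lt (by norm_num)) isSieveAdjoint_two ⟨3, isBigO_adjoint_two⟩

end IsBetaSieveSolution

/-- For `κ = 1` the minimality clause of `IsBetaSieveData` is automatic (all normalised solutions
have `β = 2`): `IsBetaSieveData 1 B` iff `B` solves the normalised system. [folklore] -/
theorem isBetaSieveData_one_iff (B : (ℝ → ℝ) × (ℝ → ℝ) × ℝ × ℝ) :
    IsBetaSieveData 1 B ↔ IsBetaSieveSolution 1 B.1 B.2.1 B.2.2.1 B.2.2.2 :=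
  ⟨fun h => h.1, fun h => ⟨h, fun _ _ _ _ h' => by rw [h.beta_eq_two, h'.beta_eq_two]⟩⟩

/-- For `κ = 1/2` the minimality clause of `IsBetaSieveData` is automatic (all normalised
solutions have `β = 1`). [folklore] -/
theorem isBetaSieveData_half_iff (B : (ℝ → ℝ) × (ℝ → ℝ) × ℝ × ℝ) :
    IsBetaSieveData (1 / 2) B ↔ IsBetaSieveSolution (1 / 2) B.1 B.2.1 B.2.2.1 B.2.2.2 :=
  ⟨fun h => h.1, fun h => ⟨h, fun _ _ _ _ h' => by rw [h.beta_eq_one, h'.beta_eq_one]⟩⟩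

/-- **`β_1 = 2` from existence**: the named fact `siftingLimit_one` (`siftingLimit 1 = 2`) of
`SieveFunctions` follows from the existence fact `exists_isBetaSieveData` alone, since every
normalised solution of dimension `1` has `β = 2` (`IsBetaSieveSolution.beta_eq_two`).
[cite: Greaves2001, §4.2.4 (4.9)–(4.10)] -/
theorem siftingLimit_one_of_exists (hex : exists_isBetaSieveData) : siftingLimit_one :=
  (isBetaSieveSolution_upperSieveFun_lowerSieveFun hex (by norm_num)).beta_eq_two

/-- For dimension `2`, granted existence (`exists_isBetaSieveData`), the parameter
`siftingLimit 2` of `SieveFunctions` satisfies `q_2(siftingLimit 2 − 1) = 0` — it is `1 +` SOME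
zero of `q_2`, not necessarily the greatest one `β_2 − 1 = 3.83399` (see the correction section of
`SieveFunctions`, `IsGreatestBetaSieveData`).
[cite: Greaves2001, §4.2.4 (4.7), (4.10)] -/
theorem cubic_siftingLimit_two_eq_zero (hex : exists_isBetaSieveData) :
    (siftingLimit 2 - 1) ^ 3 - 6 * (siftingLimit 2 - 1) ^ 2 + 9 * (siftingLimit 2 - 1) - 8 / 3 = 0 :=
  (isBetaSieveSolution_upperSieveFun_lowerSieveFun hex (by norm_num)).cubic_eq_zero


end Literature.NumberTheory.Sieve
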